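import Mathlib
import HarnessLib
import Summits.HubbardSuperconductivity.HubbardSuperconductivity.Theorems.KLProgrammeKLRegimeCountertermJacksonFrameBounds

/-!
# Route `KLProgramme` — crux K3, child Counterterm under Δ23 / (R-I-min): the Jackson mean COMMUTES WITH DERIVATIVES — `‖Dʲ(𝒥_d F)‖ ≤ sup‖DʲF‖`, constant ONE (part 4 of the smoothing layer)

The heart of «fixed point on FrameOK's tube» under (R-I-min): the smoothing `𝒥_d` (`jsmooth` / `jacksonFrame` of `…CountertermJacksonFrame`) is a
self-map of the `C⁴` tube with ALL allowances frozen, because a nonnegative kernel of mass one passes sup bounds of every derivative with constant one.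

* §7 `iteratedFDeriv_smul_translate`, **`contDiff_integral_translate`**, `norm_iteratedFDeriv_integral_translate_le` — dominated differentiation of
  FINITE order for translation integrands `x ↦ ∫ c(w)·G(x − e(w)) dμ` (`c, e` continuous on `ℝ × ℝ`, `μ` finite, `G ∈ Cᵐ` with bounded derivatives):
  `Cᵐ`, `Dʲ∫ = ∫Dʲ` (`j ≤ m`), and `‖Dʲ∫‖ ≤ (∫c)·sup‖DʲG‖` for `c ≥ 0` — the argument of
  `Literature.Analysis.FunctionSpaces.contDiff_integral_of_dominated_iteratedFDeriv` (Mathlib's `hasFDerivAt_integral_of_dominated_of_fderiv_le`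
  iterated along `Dʲ⁺¹ = curry⁻¹ ∘ D(Dʲ)`), re-run for finite smoothness with measurability from continuity;
* §8 `jsmooth_eq_integral_translate` (Fubini: the Jackson mean as ONE Bochner integral of a weighted translate of `F ∘ ofLp` over the product measure
  of `(−π,π]²`), `integral_jker_prod` (mass one), **`contDiff_jsmooth_and_norm_iteratedFDeriv_le` (J2)**: for `F` continuous with `F ∘ ofLp ∈ Cᵐ(ℝ²)`
  and `‖Dⁱ(F ∘ ofLp)‖ ≤ Bᵢ` (`i ≤ m`), `q ↦ 𝒥_d F(q)` is `Cᵐ` and `‖Dʲ(𝒥_d F)(q)‖ ≤ Bⱼ` for every `j ≤ m`, uniformly in `d`; and on the frame,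
  **`norm_iteratedFDeriv_eval_jacksonFrame_le`**: the same for `q ↦ (jacksonFrame d F).eval (ofLp q)` (= `evalM (jacksonFrame d F)`) when `F` is a
  symmetric frame — so FrameOK (ii)'s piece sizes (`Gfr`, `msBar`, `klMsKappa = 64`, `twoLegBar`) pass to the smoothed frame VERBATIM.

Pure real analysis.  Seat hubbard-kl-k3c3-p2 (g3); HOME/hubbard-kl-k3c3-p2/DELTA23-CHILD2.md §3 (J2).
-/

noncomputable section

namespace Summit.HubbardSuperconductivity.HubbardSuperconductivity.Theorems.KLRegimeSplit

set_option linter.dupNamespace false -- summit = problem name (single-conjunct summit), D-0017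

open Real MeasureTheory Filter Metric Function
open scoped Topology ContDiff

/-! ## §7 Iterated differentiation under the integral sign for translation integrands `c(w)·G(x − e(w))` of finite smoothness -/

section Translate

variable {E : Type*} [NormedAddCommGroup E] [NormedSpace ℝ E]
variable {μ : Measure (ℝ × ℝ)} [IsFiniteMeasure μ]

/-- The iterated derivative of a weighted translate: `Dⁱ(c·G(· − v))(x) = c·DⁱG(x − v)`. -/
theorem iteratedFDeriv_smul_translate {G : E → ℝ} {m : ℕ} (hG : ContDiff ℝ m G) (c : ℝ) (v x : E) {i : ℕ} (hi : i ≤ m) :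
    iteratedFDeriv ℝ i (fun y => c • G (y - v)) x = c • iteratedFDeriv ℝ i G (x - v) := by
  have h1 : ContDiff ℝ i (fun y : E => G (y - v)) := (hG.of_le (by exact_mod_cast hi)).comp (contDiff_id.sub contDiff_const)
  rw [iteratedFDeriv_const_smul_apply' (f := fun y => G (y - v)) h1.contDiffAt, iteratedFDeriv_comp_sub]

/-- **Finite-order dominated differentiation for translation integrands.**  For `c, e` continuous on `ℝ × ℝ` with `|c| ≤ C`, a finite
measure `μ`, and `G ∈ Cᵐ(E)` with `‖DⁱG‖ ≤ Bᵢ` (`i ≤ m`): `x ↦ ∫ c(w) G(x − e(w)) dμ` is `Cᵐ` and `Dʲ(∫ c G(· − e))(x) = ∫ c(w) DʲG(x − e(w)) dμ`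
for `j ≤ m`.  (Mathlib's `hasFDerivAt_integral_of_dominated_of_fderiv_le` iterated along `Dʲ⁺¹ = curry⁻¹ ∘ D(Dʲ)`, the top order by dominated
continuity — the argument of `Literature.Analysis.FunctionSpaces.contDiff_integral_of_dominated_iteratedFDeriv`, here for FINITE smoothness with
measurability from continuity.) -/
theorem contDiff_integral_translate {c : ℝ × ℝ → ℝ} {e : ℝ × ℝ → E} (hc : Continuous c) (he : Continuous e) {C : ℝ} (hC : ∀ w, |c w| ≤ C)
    {G : E → ℝ} {m : ℕ} (hG : ContDiff ℝ m G) {B : ℕ → ℝ} (hB : ∀ i ≤ m, ∀ x, ‖iteratedFDeriv ℝ i G x‖ ≤ B i) :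
    ContDiff ℝ m (fun x => ∫ w, c w • G (x - e w) ∂μ) ∧
      ∀ j ≤ m, ∀ x, iteratedFDeriv ℝ j (fun x => ∫ w, c w • G (x - e w) ∂μ) x = ∫ w, c w • iteratedFDeriv ℝ j G (x - e w) ∂μ := by
  -- the integrand family and its derivatives
  let N : ℝ × ℝ → E → ℝ := fun w x => c w • G (x - e w)
  have hN : ∀ w, ∀ i ≤ m, ∀ x, iteratedFDeriv ℝ i (N w) x = c w • iteratedFDeriv ℝ i G (x - e w) := fun w i hi x =>
    iteratedFDeriv_smul_translate hG (c w) (e w) x hi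
  have hs : ∀ w, ContDiff ℝ m (N w) := fun w => ((hG.comp (contDiff_id.sub contDiff_const)).const_smul (c w))
  -- the candidate derivatives
  let Bf : (i : ℕ) → E → E [×i]→L[ℝ] ℝ := fun i x => ∫ w, iteratedFDeriv ℝ i (N w) x ∂μ
  let L : (i : ℕ) → (E [×(i + 1)]→L[ℝ] ℝ) ≃ₗᵢ[ℝ] (E →L[ℝ] E [×i]→L[ℝ] ℝ) := fun i =>
    continuousMultilinearCurryLeftEquiv ℝ (fun _ : Fin (i + 1) => E) ℝ
  have hcont2 : ∀ i ≤ m, Continuous (fun q : (ℝ × ℝ) × E => iteratedFDeriv ℝ i (N q.1) q.2) := by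
    intro i hi
    have hfun : (fun q : (ℝ × ℝ) × E => iteratedFDeriv ℝ i (N q.1) q.2) =
        fun q => c q.1 • iteratedFDeriv ℝ i G (q.2 - e q.1) := funext fun q => hN q.1 i hi q.2
    rw [hfun]
    exact (hc.comp continuous_fst).smul
      ((hG.continuous_iteratedFDeriv (by exact_mod_cast hi)).comp (continuous_snd.sub (he.comp continuous_fst)))
  have hmeas : ∀ i ≤ m, ∀ x, AEStronglyMeasurable (fun w => iteratedFDeriv ℝ i (N w) x) μ := fun i hi x =>
    ((hcont2 i hi).comp (Continuous.prodMk_left x)).aestronglyMeasurable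
  have hb : ∀ i ≤ m, ∀ w x, ‖iteratedFDeriv ℝ i (N w) x‖ ≤ C * B i := by
    intro i hi w x
    rw [hN w i hi x, norm_smul, Real.norm_eq_abs]
    have hB0 : 0 ≤ B i := le_trans (norm_nonneg _) (hB i hi (x - e w))
    exact mul_le_mul (hC w) (hB i hi _) (norm_nonneg _) (le_trans (abs_nonneg _) (hC w))
  have hbi : ∀ i ≤ m, Integrable (fun _ : ℝ × ℝ => C * B i) μ := fun i _ => integrable_const _
  have hint : ∀ i ≤ m, ∀ x, Integrable (fun w => iteratedFDeriv ℝ i (N w) x) μ := fun i hi x =>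
    (hbi i hi).mono' (hmeas i hi x) (Eventually.of_forall fun w => hb i hi w x)
  -- one derivative under the integral sign
  have hQ : ∀ i, i + 1 ≤ m → ∀ x, HasFDerivAt (Bf i) (L i (Bf (i + 1) x)) x := by
    intro i hi x
    have hi' : i ≤ m := (Nat.le_succ i).trans hi
    have hdiff : ∀ w y, HasFDerivAt (fun y => iteratedFDeriv ℝ i (N w) y)
        (fderiv ℝ (iteratedFDeriv ℝ i (N w)) y) y := fun w y =>
      (((hs w).differentiable_iteratedFDeriv (m := i) (by exact_mod_cast Nat.lt_of_succ_le hi)) y).hasFDerivAt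
    have hF'm : AEStronglyMeasurable (fun w => fderiv ℝ (iteratedFDeriv ℝ i (N w)) x) μ := by
      have : (fun w => fderiv ℝ (iteratedFDeriv ℝ i (N w)) x) =
          fun w => L i (iteratedFDeriv ℝ (i + 1) (N w) x) := by
        funext w; rfl
      rw [this]
      exact (L i).continuous.comp_aestronglyMeasurable (hmeas (i + 1) hi x)
    have h := hasFDerivAt_integral_of_dominated_of_fderiv_le (μ := μ)
      (F := fun y w => iteratedFDeriv ℝ i (N w) y)
      (F' := fun y w => fderiv ℝ (iteratedFDeriv ℝ i (N w)) y) (bound := fun _ => C * B (i + 1))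
      (ball_mem_nhds x zero_lt_one) (Eventually.of_forall fun y => hmeas i hi' y) (hint i hi' x) hF'm
      (Eventually.of_forall fun w y _ => by
        rw [norm_fderiv_iteratedFDeriv]; exact hb (i + 1) hi w y)
      (hbi (i + 1) hi) (Eventually.of_forall fun w y _ => hdiff w y)
    have hval : (∫ w, fderiv ℝ (iteratedFDeriv ℝ i (N w)) x ∂μ) = L i (Bf (i + 1) x) := by
      show (∫ w, (L i).toLinearIsometry (iteratedFDeriv ℝ (i + 1) (N w) x) ∂μ) = _
      exact LinearIsometry.integral_comp_comm (X := ℝ × ℝ) (μ := μ) (𝕜 := ℝ) (E := E [×(i + 1)]→L[ℝ] ℝ)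
        (F := E →L[ℝ] E [×i]→L[ℝ] ℝ) (L i).toLinearIsometry _
    rwa [hval] at h
  -- continuity of every `Bf i`, `i ≤ m`
  have hcont : ∀ i ≤ m, Continuous (Bf i) := fun i hi =>
    continuous_of_dominated (fun x => hmeas i hi x) (fun x => Eventually.of_forall fun w => hb i hi w x)
      (hbi i hi) (Eventually.of_forall fun w =>
        ((hs w).continuous_iteratedFDeriv (m := i) (by exact_mod_cast hi)))
  -- `Bf i ∈ C^j` whenever `i + j ≤ m`
  have hS : ∀ j i, i + j ≤ m → ContDiff ℝ j (Bf i) := by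
    intro j
    induction j with
    | zero => intro i hi; exact contDiff_zero.2 (hcont i (by omega))
    | succ j ih =>
      intro i hi
      have hi1 : i + 1 ≤ m := by omega
      have hd : ∀ x, HasFDerivAt (Bf i) (L i (Bf (i + 1) x)) x := hQ i hi1
      have hfd : fderiv ℝ (Bf i) = fun x => L i (Bf (i + 1) x) := funext fun x => (hd x).fderiv
      rw [show ((j + 1 : ℕ) : WithTop ℕ∞) = (j : WithTop ℕ∞) + 1 by push_cast; ring,
        contDiff_succ_iff_fderiv]
      refine ⟨fun x => (hd x).differentiableAt, fun h => absurd h (by simp), ?_⟩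
      rw [hfd]
      exact (LinearIsometryEquiv.contDiff (E := E [×(i + 1)]→L[ℝ] ℝ)
        (F := E →L[ℝ] E [×i]→L[ℝ] ℝ) (L i)).comp (ih (i + 1) (by omega))
  -- the integral itself
  have hf : (fun x => ∫ w, N w x ∂μ) = fun x => (continuousMultilinearCurryFin0 ℝ E ℝ) (Bf 0 x) := by
    funext x
    have : Bf 0 x = ∫ w, (continuousMultilinearCurryFin0 ℝ E ℝ).symm.toLinearIsometry (N w x) ∂μ := rfl
    rw [this, LinearIsometry.integral_comp_comm (X := ℝ × ℝ) (μ := μ) (𝕜 := ℝ) (E := ℝ)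
      (F := E [×0]→L[ℝ] ℝ)]
    simp
  have hR : ∀ j ≤ m, iteratedFDeriv ℝ j (fun x => ∫ w, N w x ∂μ) = Bf j := by
    intro j
    induction j with
    | zero =>
      intro _
      funext x
      rw [iteratedFDeriv_zero_eq_comp, Function.comp_apply,
        show (∫ w, N w x ∂μ) = continuousMultilinearCurryFin0 ℝ E ℝ (Bf 0 x) from congrFun hf x]
      simp
    | succ j ih =>
      intro hj
      have hfd : fderiv ℝ (Bf j) = fun x => L j (Bf (j + 1) x) :=
        funext fun x => (hQ j hj x).fderiv
      rw [iteratedFDeriv_succ_eq_comp_left, ih ((Nat.le_succ j).trans hj), hfd]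
      funext x
      simp only [Function.comp_apply, L, LinearIsometryEquiv.symm_apply_apply]
  refine ⟨?_, fun j hj x => ?_⟩
  · show ContDiff ℝ m (fun x => ∫ w, N w x ∂μ)
    rw [hf]
    exact (LinearIsometryEquiv.contDiff (E := E [×0]→L[ℝ] ℝ) (F := ℝ)
      (continuousMultilinearCurryFin0 ℝ E ℝ)).comp (hS m 0 (by omega))
  · show iteratedFDeriv ℝ j (fun x => ∫ w, N w x ∂μ) x = _
    rw [hR j hj]
    show (∫ w, iteratedFDeriv ℝ j (N w) x ∂μ) = _
    exact integral_congr_ae (Eventually.of_forall fun w => hN w j hj x)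

/-- **Sup bounds pass under the integral with the kernel's mass**: under the hypotheses of `contDiff_integral_translate` with `c ≥ 0`,
`‖Dʲ(∫ c G(· − e))(x)‖ ≤ (∫ c dμ) · sup‖DʲG‖`. -/
theorem norm_iteratedFDeriv_integral_translate_le {c : ℝ × ℝ → ℝ} {e : ℝ × ℝ → E} (hc : Continuous c) (he : Continuous e)
    (hc0 : ∀ w, 0 ≤ c w) {C : ℝ} (hC : ∀ w, c w ≤ C)
    {G : E → ℝ} {m : ℕ} (hG : ContDiff ℝ m G) {B : ℕ → ℝ} (hB : ∀ i ≤ m, ∀ x, ‖iteratedFDeriv ℝ i G x‖ ≤ B i)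
    {j : ℕ} (hj : j ≤ m) (x : E) :
    ‖iteratedFDeriv ℝ j (fun x => ∫ w, c w • G (x - e w) ∂μ) x‖ ≤ (∫ w, c w ∂μ) * B j := by
  have hC' : ∀ w, |c w| ≤ C := fun w => by rw [abs_of_nonneg (hc0 w)]; exact hC w
  rw [(contDiff_integral_translate hc he hC' hG hB).2 j hj x]
  have hB0 : 0 ≤ B j := le_trans (norm_nonneg _) (hB j hj x)
  have hci : Integrable c μ := (integrable_const C).mono' hc.aestronglyMeasurable
    (Eventually.of_forall fun w => by rw [Real.norm_eq_abs]; exact hC' w)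
  calc ‖∫ w, c w • iteratedFDeriv ℝ j G (x - e w) ∂μ‖
      ≤ ∫ w, ‖c w • iteratedFDeriv ℝ j G (x - e w)‖ ∂μ := norm_integral_le_integral_norm _
    _ ≤ ∫ w, c w * B j ∂μ := by
        refine integral_mono_of_nonneg (Eventually.of_forall fun w => norm_nonneg _) (hci.mul_const _)
          (Eventually.of_forall fun w => ?_)
        show ‖c w • iteratedFDeriv ℝ j G (x - e w)‖ ≤ c w * B j
        rw [norm_smul, Real.norm_eq_abs, abs_of_nonneg (hc0 w)]
        exact mul_le_mul_of_nonneg_left (hB j hj _) (hc0 w)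
    _ = (∫ w, c w ∂μ) * B j := integral_mul_const _ _

end Translate

/-! ## §8 (J2) The Jackson mean commutes with derivatives: `Cᵐ` and `‖Dʲ(𝒥_d F)‖ ≤ sup ‖DʲF‖` with CONSTANT ONE -/

section JsmoothDeriv

open intervalIntegral Literature.MathematicalPhysics.QuantumLattice

variable (d : ℕ) {F : (Fin 2 → ℝ) → ℝ}

/-- The product measure of the smoothing square `(−π, π]²`. -/
theorem isFiniteMeasure_jsmoothMeasure :
    IsFiniteMeasure ((volume.restrict (Set.Ioc (-π) π)).prod (volume.restrict (Set.Ioc (-π) π)) : Measure (ℝ × ℝ)) := by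
  infer_instance

/-- **The Jackson mean as ONE Bochner integral of a weighted translate** of `G = F ∘ ofLp` over the product measure (Fubini). -/
theorem jsmooth_eq_integral_translate (hF : Continuous F) (q : EuclideanSpace ℝ (Fin 2)) :
    jsmooth d F (WithLp.ofLp q) =
      ∫ w, (jker d w.1 * jker d w.2) • (fun x : EuclideanSpace ℝ (Fin 2) => F (WithLp.ofLp x))
        (q - WithLp.toLp 2 ![w.1, w.2]) ∂((volume.restrict (Set.Ioc (-π) π)).prod (volume.restrict (Set.Ioc (-π) π))) := by
  have hππ : -π ≤ π := by linarith [Real.pi_pos]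
  -- pointwise form of the integrand
  have hpt : ∀ w : ℝ × ℝ, (jker d w.1 * jker d w.2) • (fun x : EuclideanSpace ℝ (Fin 2) => F (WithLp.ofLp x))
      (q - WithLp.toLp 2 ![w.1, w.2]) = jker d w.1 * jker d w.2 * F ![q 0 - w.1, q 1 - w.2] := by
    intro w
    simp only [smul_eq_mul]
    congr 1
    congr 1
    ext i; fin_cases i <;> simp
  simp_rw [hpt]
  unfold jsmooth
  rw [intervalIntegral.integral_of_le hππ]
  simp_rw [intervalIntegral.integral_of_le hππ]
  -- integrability of a continuous function on the bounded square
  have hcont : Continuous fun w : ℝ × ℝ => jker d w.1 * jker d w.2 * F ![q 0 - w.1, q 1 - w.2] :=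
    continuous_jsmoothIntegrand d hF (WithLp.ofLp q)
  have hint : Integrable (fun w : ℝ × ℝ => jker d w.1 * jker d w.2 * F ![q 0 - w.1, q 1 - w.2])
      ((volume.restrict (Set.Ioc (-π) π)).prod (volume.restrict (Set.Ioc (-π) π))) := by
    rw [Measure.prod_restrict, show (volume : Measure ℝ).prod volume = volume from rfl]
    exact (hcont.continuousOn.integrableOn_compact ((isCompact_Icc (a := -π) (b := π)).prod
      (isCompact_Icc (a := -π) (b := π)))).mono_set (Set.prod_mono Set.Ioc_subset_Icc_self Set.Ioc_subset_Icc_self)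
  rw [MeasureTheory.integral_prod _ hint]

/-- The kernel weight integrates to one over the product measure. -/
theorem integral_jker_prod :
    ∫ w, jker d w.1 * jker d w.2 ∂((volume.restrict (Set.Ioc (-π) π)).prod (volume.restrict (Set.Ioc (-π) π)) : Measure (ℝ × ℝ)) = 1 := by
  have hππ : -π ≤ π := by linarith [Real.pi_pos]
  rw [MeasureTheory.integral_prod_mul (μ := volume.restrict (Set.Ioc (-π) π)) (ν := volume.restrict (Set.Ioc (-π) π))
    (f := fun s => jker d s) (g := fun t => jker d t)]
  rw [← intervalIntegral.integral_of_le hππ, integral_jker, one_mul]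

/-- A uniform bound of the kernel. -/
theorem jker_le_const (s : ℝ) : jker d s ≤ π ^ 4 * (d + 1) / 8 / (2 * π) := by
  unfold jker
  exact div_le_div_of_nonneg_right (jackson_le_const d _) (by positivity)

/-- **(J2) The Jackson mean is `Cᵐ` and its derivatives are bounded by those of the symbol, CONSTANT ONE.**  For `F` continuous with
`G = F ∘ ofLp ∈ Cᵐ(ℝ²)` (Euclidean) and `‖DⁱG‖ ≤ Bᵢ` for `i ≤ m`: `q ↦ 𝒥_d F(q)` is `Cᵐ` and `‖Dʲ(𝒥_d F)(q)‖ ≤ Bⱼ` for every `j ≤ m`, uniformly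
in `d` — positivity and mass one of the kernel; this is what makes `𝒥_d` a self-map of FrameOK's `C⁴` tube with all allowances FROZEN. -/
theorem contDiff_jsmooth_and_norm_iteratedFDeriv_le (hF : Continuous F) {m : ℕ}
    (hG : ContDiff ℝ m (fun x : EuclideanSpace ℝ (Fin 2) => F (WithLp.ofLp x))) {B : ℕ → ℝ}
    (hB : ∀ i ≤ m, ∀ x, ‖iteratedFDeriv ℝ i (fun x : EuclideanSpace ℝ (Fin 2) => F (WithLp.ofLp x)) x‖ ≤ B i) :
    ContDiff ℝ m (fun q : EuclideanSpace ℝ (Fin 2) => jsmooth d F (WithLp.ofLp q)) ∧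
      ∀ j ≤ m, ∀ q, ‖iteratedFDeriv ℝ j (fun q : EuclideanSpace ℝ (Fin 2) => jsmooth d F (WithLp.ofLp q)) q‖ ≤ B j := by
  set μ : Measure (ℝ × ℝ) := (volume.restrict (Set.Ioc (-π) π)).prod (volume.restrict (Set.Ioc (-π) π)) with hμ
  haveI : IsFiniteMeasure μ := isFiniteMeasure_jsmoothMeasure
  have hfun : (fun q : EuclideanSpace ℝ (Fin 2) => jsmooth d F (WithLp.ofLp q)) =
      fun q => ∫ w, (jker d w.1 * jker d w.2) • (fun x : EuclideanSpace ℝ (Fin 2) => F (WithLp.ofLp x))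
        (q - WithLp.toLp 2 ![w.1, w.2]) ∂μ := funext fun q => jsmooth_eq_integral_translate d hF q
  rw [hfun]
  have hc : Continuous fun w : ℝ × ℝ => jker d w.1 * jker d w.2 :=
    ((continuous_jker d).comp continuous_fst).mul ((continuous_jker d).comp continuous_snd)
  have he : Continuous fun w : ℝ × ℝ => (WithLp.toLp 2 ![w.1, w.2] : EuclideanSpace ℝ (Fin 2)) := by
    refine (PiLp.continuous_toLp 2 _).comp ?_
    refine continuous_pi fun i => ?_
    fin_cases i <;> simp <;> fun_prop
  have hc0 : ∀ w : ℝ × ℝ, 0 ≤ jker d w.1 * jker d w.2 := fun w => mul_nonneg (jker_nonneg d _) (jker_nonneg d _)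
  have hC : ∀ w : ℝ × ℝ, jker d w.1 * jker d w.2 ≤ (π ^ 4 * (d + 1) / 8 / (2 * π)) * (π ^ 4 * (d + 1) / 8 / (2 * π)) := fun w =>
    mul_le_mul (jker_le_const d w.1) (jker_le_const d w.2) (jker_nonneg d w.2) (le_trans (jker_nonneg d w.1) (jker_le_const d w.1))
  have hC' : ∀ w : ℝ × ℝ, |jker d w.1 * jker d w.2| ≤ (π ^ 4 * (d + 1) / 8 / (2 * π)) * (π ^ 4 * (d + 1) / 8 / (2 * π)) :=
    fun w => by rw [abs_of_nonneg (hc0 w)]; exact hC w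
  refine ⟨(contDiff_integral_translate (μ := μ) hc he hC' hG hB).1, fun j hj q => ?_⟩
  have h := norm_iteratedFDeriv_integral_translate_le (μ := μ) hc he hc0 hC hG hB hj q
  rw [integral_jker_prod, one_mul] at h
  exact h

/-- **(J2) on the frame**: for a symmetric frame `F` (continuous, `2π`-periodic, reflection- and swap-symmetric) with `F ∘ ofLp ∈ Cᵐ` and
`‖Dⁱ(F ∘ ofLp)‖ ≤ Bᵢ` (`i ≤ m`), the `TrigPolyC4v` `jacksonFrame d F` read on `ℝ²` is `Cᵐ` with `‖Dʲ‖ ≤ Bⱼ` for all `j ≤ m` — FrameOK (ii)'s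
piece sizes pass to the smoothed frame VERBATIM. -/
theorem norm_iteratedFDeriv_eval_jacksonFrame_le (hF : Continuous F)
    (hper : ∀ (p : Fin 2 → ℝ) (z : Fin 2 → ℤ), F (fun i => p i + z i * (2 * π)) = F p)
    (hrefl : ∀ p : Fin 2 → ℝ, F ![p 0, -p 1] = F p) (hswap : ∀ p : Fin 2 → ℝ, F ![p 1, p 0] = F p) {m : ℕ}
    (hG : ContDiff ℝ m (fun x : EuclideanSpace ℝ (Fin 2) => F (WithLp.ofLp x))) {B : ℕ → ℝ}
    (hB : ∀ i ≤ m, ∀ x, ‖iteratedFDeriv ℝ i (fun x : EuclideanSpace ℝ (Fin 2) => F (WithLp.ofLp x)) x‖ ≤ B i) :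
    ContDiff ℝ m (fun q : EuclideanSpace ℝ (Fin 2) => (jacksonFrame d F).eval (WithLp.ofLp q)) ∧
      ∀ j ≤ m, ∀ q, ‖iteratedFDeriv ℝ j (fun q : EuclideanSpace ℝ (Fin 2) => (jacksonFrame d F).eval (WithLp.ofLp q)) q‖ ≤ B j := by
  have hfun : (fun q : EuclideanSpace ℝ (Fin 2) => (jacksonFrame d F).eval (WithLp.ofLp q)) =
      fun q => jsmooth d F (WithLp.ofLp q) := funext fun q => eval_jacksonFrame hF hper hrefl hswap d _
  rw [hfun]
  exact contDiff_jsmooth_and_norm_iteratedFDeriv_le d hF hG hB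

end JsmoothDeriv

end Summit.HubbardSuperconductivity.HubbardSuperconductivity.Theorems.KLRegimeSplit

end
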